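import Summits.BirchSwinnertonDyer.BirchSwinnertonDyer.Theorems.PrintX11aLowerHalfNonSurjChain
import HarnessLib

/-!
# Crux `X11aLowerHalf` (item stmt-BirchSwinnertonDyer-19064), NON-SURJECTIVE sub-leaf, `p ≥ 5`: the
# EPW ∕ Wan Hida-family chain WITHOUT surjectivity — part B, the doors and the class-level corollaries
# (`--supports stmt-BirchSwinnertonDyer-19064`; seat bsd-line-er5-p2 = -w3 width seat of the 19064
# line r1 «off-unit», registered stub `stub_lowerNonSurjDeep`; part A = `…NonSurjChain.lean`)

HONEST FRAMING. Theorems only; no definition, no named fact, no `sorry`. Nothing here closes the crux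
`X11aLowerHalf` or the registered stub `stub_lowerNonSurjDeep` (OPEN class-wide); every theorem below
is CONDITIONAL on displayed named facts (sixteen Literature facts incl. part A's (irred) instance of
Wan 2015 Thm. 4, + Greenberg–Stevens at the pair) and on the per-pair certificate `μ^an(E,p) = 0` or
on the `∀`-statements `Theorems.NonSurjCornerTwinMuAn` (item 19948) ∕ a `∀`-certificate hypothesis —
Greenberg's `μ`-conjecture at class level (barrier B3). BSD is not proved for any curve or class by this
file. beyond-print theorem: no.

* §3 doors on `ClassX11a` at a NON-surjective pair, `p ≥ 5` (part A §2 + p607778's endpoint, the typed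
  divisibility from `ClassX11a.multDivisibilityAt_of_muAnZeroAt_of_not_surj`):
  `ClassX11a.mazurMainConjectureAt_of_muAnZeroAt_of_not_surj_of_facts`,
  `ClassX11a.bsdp_of_muAnZeroAt_of_not_surj_of_facts` (BOTH Miller halves: at such a pair crux L
  `X11aLowerHalf` (19064) and crux U `X11aNonSurjEulerHalf` (20406 ∕ 20614) have ONE residual, the
  certificate), **`ClassX11a.missingLowerBoundAt_of_muAnZeroAt_of_not_surj_of_facts`** (crux-L currency
  = the body of `stub_lowerNonSurjDeep` AT THE PAIR).
* §4 class level: `lowerNonSurjDeep_five_of_forall_muAnZeroAt_of_facts` (the registered stub RESTRICTED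
  TO `p ≥ 5` ⟸ facts + `∀` certificates); `lowerNonSurj_fiveSeven_of_nonSurjCornerTwinMuAn_of_facts`
  (⟸ facts + the K2 constant `Theorems.NonSurjCornerTwinMuAn` = item 19948 BY NAME, whose body IS
  `μ^an = 0` on the whole non-surjective X11a locus at `p ∈ {5,7}`);
  `lowerNonSurj_five_of_nonSurjCornerTwinMuAn_of_facts` (`p ≥ 5`; + BDMTV `hB`). CONSEQUENCE for route
  ErratumRoadFive (planner's call): the corner's 5th binder `NonSurjCornerLowerX11a` (item 19950 :=
  19064) is consumed only at non-surjective twists with `p ∈ {5,7}`, where it now follows from the 3rd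
  binder (`NonSurjCornerTwinMuAn`, 19948) + named facts.

What remains OPEN on `stub_lowerNonSurjDeep`: (i) `p ≥ 5`: the certificate class-wide on the deep
non-surjective X11a pairs (images 5Ns ∕ 5S4 ∕ 7Ns; census N < 5·10⁵: none deep, all 56 ¬Surj pairs @5
are unit pairs; members exist out of range, e.g. the K2 twin frames) = Greenberg Conj. 1.11 there =
item 19948's content; (ii) `p = 3` (images 3Ns ∕ 3Nn): no chain (EPW ∕ Wan typed for `p ≥ 5`).

References: [EmertonPollackWeston2006] Thm. 1, Thm. 3.1.1, Thm. 5.1.3; [Wan2015] Thm. 4;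
[Kato2004Asterisque] Thm. 12.4, §17.13; [Wuthrich2014] Cor. 18; [SteinWuthrich2013] Thm. 6.1;
[Miller2011LMS] Def. 1.1; [BalakrishnanEtAl2019] Thm. 1.2; [SilvermanATAEC1994] V.6 Prop. 6.1;
cell files `pub/bsd-print-x11a/P3-EXCEPTIONAL-ZERO-ROAD.md` §5–§6, `pub/bsd-stepL/line-er5-p2/`.
-/

set_option autoImplicit false
set_option linter.dupNamespace false -- the directory name repeats the summit name (sibling precedent)

noncomputable section

open scoped Classical MatrixGroups ModularForm

open CongruenceSubgroup WeierstrassCurve Literature.NumberTheory.EllipticCurves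
  Literature.NumberTheory.EllipticCurves.ModularForms
  Literature.NumberTheory.EllipticCurves.Rank1Residual
  Literature.NumberTheory.EllipticCurves.Rank1Residual.Typed
  Literature.NumberTheory.EllipticCurves.Wuthrich2014
  Literature.NumberTheory.EllipticCurves.SteinWuthrich2013
  Literature.NumberTheory.EllipticCurves.Greenberg1999
  Literature.NumberTheory.EllipticCurves.Kato2004
  Literature.NumberTheory.EllipticCurves.GreenbergVatsal2000
  Literature.NumberTheory.EllipticCurves.EmertonPollackWeston2006
  Literature.NumberTheory.EllipticCurves.BalakrishnanEtAl2019
  Literature.NumberTheory.GaloisRepresentations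
  Summit.BirchSwinnertonDyer.Rank1Residual
  Summit.BirchSwinnertonDyer.Rank1Residual.X1.MuLambda
  Summit.BirchSwinnertonDyer.Rank1Residual.X11a
  Summit.BirchSwinnertonDyer.Rank1Residual.X11a.LambdaNorm
  Summit.BirchSwinnertonDyer.Rank1Residual.X11a.Chain

namespace Summit.BirchSwinnertonDyer.BirchSwinnertonDyer.Theorems.NonSurjChain

/-! ### §3 Doors on `ClassX11a`, NON-surjective image, `p ≥ 5`: the certificate ⟹ the lower half -/

section Doors

variable {W : WeierstrassCurve ℚ} [W.IsElliptic] [W.IsGloballyMinimal] {p : ℕ} [Fact p.Prime]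

/-- **Mazur's main conjecture at a NON-surjective X11a pair, `p ≥ 5`, from the certificate
`μ^an(E,p) = 0` ALONE (modulo named facts)**: §2 (invariants) + p607778's endpoint, with the typed
divisibility from `ClassX11a.multDivisibilityAt_of_muAnZeroAt_of_not_surj`. Displayed: modularity
(`hNf`), EPW Thm. 3.1.1 ∕ Thm. 1 ∕ Thm. 5.1.3 (`h311`, `hT1a`, `hT1b`), Wan Thm. 4 (irred) (`hT2`),
Deligne–Serre 6.1 (`h61`), Hida/Wiles 3.26 (`h326`), Kato 12.4 (`h12`), §17.13 ×3 (`hns`, `hsp`, `hfine`),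
Greenberg 1.5 (`h15`), Wuthrich Cor. 18 (`h18`), Greenberg–Stevens at the pair (`hGS`). PER PAIR;
closes nothing class-wide. [cite: EmertonPollackWeston2006, Thm. 5.1.3] [cite: Wan2015, Thm. 4]
[cite: Kato2004Asterisque, Thm. 12.4 (p. 221), §17.13 (pp. 279–280)] [cite: GreenbergStevens1993, Thm. (0.3) (p. 407)] -/
theorem _root_.Summit.BirchSwinnertonDyer.Rank1Residual.ClassX11a.mazurMainConjectureAt_of_muAnZeroAt_of_not_surj_of_facts
    (hNf : exists_isNewformOf)
    (h311 : thm311_cotorsion_weightK_member_ofLevel) (hT1a : thm1_muAlg_of_weightK_member_ofLevel)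
    (hT2 : Wan2015.thm4_rational_weightK_member_of_bdd_ofLevel_irred)
    (hT1b : thm513_transfer_from_weightK_member_of_bdd_ofLevel)
    (h61 : DeligneSerre1974.thm61_exists_adicGaloisRep) (h326 : Hida2000_thm326_ordinary)
    (h12 : Kato2004.thm12_4)
    (hns : Kato2004.exists_multDivisibilityInputs_nonsplit)
    (hsp : Kato2004.exists_multDivisibilityInputs_split)
    (h15 : thm15_isTorsion_multiplicative_rat)
    (h18 : Wuthrich2014.corollary18_padicLFunction_mem_iwasawaAlgebra_multiplicative)
    (hfine : Kato2004.exists_multDivisibilityInputs_fine)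
    (hGS : greenberg_stevens (W := W) (p := p))
    (hX : ClassX11a W p) (hnsj : ¬ Surj W p) (hp : 5 ≤ p) (hμ : X11a.MuAnZeroAt W p) :
    X2.MazurMainConjectureAt W p :=
  have hdiv : X11b.MultDivisibilityAt W p :=
    hX.multDivisibilityAt_of_muAnZeroAt_of_not_surj h12 hns hsp h15 h18 hfine hnsj hμ
  mazurMainConjectureAt_of_invariantsMatchAt_of_multDivisibilityAt
    (hasEntireLFunction_rat_of_exists_isNewformOf hNf) W p hGS hdiv hX.analyticRank_eq_zero
    (invariantsMatchAt_of_modularity_ofLevel_of_multDivisibilityAt W p hNf h311 hT1a hT2 hT1b h61 h326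
      hp hX.mult hX.irr hdiv hμ)

/-- **`BSD(E,p)` at a NON-surjective X11a pair, `p ≥ 5`, from the certificate `μ^an(E,p) = 0` ALONE
(modulo named facts)** — BOTH Miller halves (so at such a pair crux L `X11aLowerHalf` and crux U
`X11aNonSurjEulerHalf` have the SAME single residual, the certificate): the previous door through the
height-free rank-`0` socket (`+` Stein–Wuthrich Thm. 6.1 `hJs`/`hJn`, GZK `hGZK`). PER PAIR; closes
nothing class-wide. [cite: SteinWuthrich2013, Thm. 6.1 (p. 20)] [cite: Miller2011LMS, §1 and Def. 1.1]
[cite: EmertonPollackWeston2006, Thm. 5.1.3] [cite: Wan2015, Thm. 4] -/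
theorem _root_.Summit.BirchSwinnertonDyer.Rank1Residual.ClassX11a.bsdp_of_muAnZeroAt_of_not_surj_of_facts
    (hNf : exists_isNewformOf)
    (h311 : thm311_cotorsion_weightK_member_ofLevel) (hT1a : thm1_muAlg_of_weightK_member_ofLevel)
    (hT2 : Wan2015.thm4_rational_weightK_member_of_bdd_ofLevel_irred)
    (hT1b : thm513_transfer_from_weightK_member_of_bdd_ofLevel)
    (h61 : DeligneSerre1974.thm61_exists_adicGaloisRep) (h326 : Hida2000_thm326_ordinary)
    (h12 : Kato2004.thm12_4)
    (hns : Kato2004.exists_multDivisibilityInputs_nonsplit)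
    (hsp : Kato2004.exists_multDivisibilityInputs_split)
    (h15 : thm15_isTorsion_multiplicative_rat)
    (h18 : Wuthrich2014.corollary18_padicLFunction_mem_iwasawaAlgebra_multiplicative)
    (hfine : Kato2004.exists_multDivisibilityInputs_fine)
    (hJs : thm61_splitMultiplicative) (hJn : thm61_nonsplitMultiplicative)
    (hGZK : rank_eq_analyticRank_of_analyticRank_le_one)
    (hGS : greenberg_stevens (W := W) (p := p))
    (hX : ClassX11a W p) (hnsj : ¬ Surj W p) (hp : 5 ≤ p) (hμ : X11a.MuAnZeroAt W p) : BSDp W p :=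
  have hpar : nonempty_modularParametrizationData :=
    nonempty_modularParametrizationData_of_exists_isNewformOf hNf
      IsNewformOf.exists_maninConstant_ne_zero_holds
  bsdp_of_mazurMainConjectureAt_heightFree hJs hJn hGZK (hasEntireLFunction_rat_of_exists_isNewformOf hNf)
    hpar hGS hX
    (hX.mazurMainConjectureAt_of_muAnZeroAt_of_not_surj_of_facts hNf h311 hT1a hT2 hT1b h61 h326 h12 hns
      hsp h15 h18 hfine hGS hnsj hp hμ)

/-- **THE LOWER HALF at a NON-surjective X11a pair, `p ≥ 5`, from the certificate `μ^an(E,p) = 0`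
ALONE (modulo named facts)**: `Typed.MissingLowerBoundAt W p` — the body of crux `X11aLowerHalf` and
of the registered stub `stub_lowerNonSurjDeep` AT THE PAIR. Displayed: 16 named facts + Greenberg–Stevens
at the pair + the class + `¬ Surj W p` + `5 ≤ p` + the certificate. PER PAIR; the certificate is a
finite exact modular-symbol computation per pair and Greenberg's `μ`-conjecture class-wide; closes
nothing class-wide. [cite: Miller2011LMS, §1 and Def. 1.1] [cite: EmertonPollackWeston2006, Thm. 5.1.3]
[cite: Wan2015, Thm. 4] [cite: Kato2004Asterisque, §17.13 (pp. 279–280)] [cite: SteinWuthrich2013, Thm. 6.1 (p. 20)] -/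
theorem _root_.Summit.BirchSwinnertonDyer.Rank1Residual.ClassX11a.missingLowerBoundAt_of_muAnZeroAt_of_not_surj_of_facts
    (hNf : exists_isNewformOf)
    (h311 : thm311_cotorsion_weightK_member_ofLevel) (hT1a : thm1_muAlg_of_weightK_member_ofLevel)
    (hT2 : Wan2015.thm4_rational_weightK_member_of_bdd_ofLevel_irred)
    (hT1b : thm513_transfer_from_weightK_member_of_bdd_ofLevel)
    (h61 : DeligneSerre1974.thm61_exists_adicGaloisRep) (h326 : Hida2000_thm326_ordinary)
    (h12 : Kato2004.thm12_4)
    (hns : Kato2004.exists_multDivisibilityInputs_nonsplit)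
    (hsp : Kato2004.exists_multDivisibilityInputs_split)
    (h15 : thm15_isTorsion_multiplicative_rat)
    (h18 : Wuthrich2014.corollary18_padicLFunction_mem_iwasawaAlgebra_multiplicative)
    (hfine : Kato2004.exists_multDivisibilityInputs_fine)
    (hJs : thm61_splitMultiplicative) (hJn : thm61_nonsplitMultiplicative)
    (hGZK : rank_eq_analyticRank_of_analyticRank_le_one)
    (hGS : greenberg_stevens (W := W) (p := p))
    (hX : ClassX11a W p) (hnsj : ¬ Surj W p) (hp : 5 ≤ p) (hμ : X11a.MuAnZeroAt W p) :
    MissingLowerBoundAt W p :=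
  hX.missingLowerBoundAt_of_bsdp hGZK
    (hX.bsdp_of_muAnZeroAt_of_not_surj_of_facts hNf h311 hT1a hT2 hT1b h61 h326 h12 hns hsp h15 h18 hfine
      hJs hJn hGZK hGS hnsj hp hμ)

end Doors

/-! ### §4 Class level: the registered stub restricted to `p ≥ 5` from `∀` certificates ∕ from item 19948 -/

section ClassLevel

/-- **The registered stub `stub_lowerNonSurjDeep` RESTRICTED TO `p ≥ 5`, from the per-pair certificates
and the named facts**: `(∀ deep non-surjective X11a pairs with p ≥ 5, μ^an(E,p) = 0) ⟹ (∀ such pairs,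
MissingLowerBoundAt)`. The `∀`-certificate hypothesis is Greenberg's `μ`-conjecture on that locus (OPEN
class-wide; images 5Ns ∕ 5S4 ∕ 7Ns); CONDITIONAL; closes nothing by itself.
[cite: GreenbergLNM1716, Conj. 1.11 (shape)] [cite: EmertonPollackWeston2006, Thm. 5.1.3] [cite: Wan2015, Thm. 4] -/
theorem lowerNonSurjDeep_five_of_forall_muAnZeroAt_of_facts
    (hNf : exists_isNewformOf)
    (h311 : thm311_cotorsion_weightK_member_ofLevel) (hT1a : thm1_muAlg_of_weightK_member_ofLevel)
    (hT2 : Wan2015.thm4_rational_weightK_member_of_bdd_ofLevel_irred)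
    (hT1b : thm513_transfer_from_weightK_member_of_bdd_ofLevel)
    (h61 : DeligneSerre1974.thm61_exists_adicGaloisRep) (h326 : Hida2000_thm326_ordinary)
    (h12 : Kato2004.thm12_4)
    (hns : Kato2004.exists_multDivisibilityInputs_nonsplit)
    (hsp : Kato2004.exists_multDivisibilityInputs_split)
    (h15 : thm15_isTorsion_multiplicative_rat)
    (h18 : Wuthrich2014.corollary18_padicLFunction_mem_iwasawaAlgebra_multiplicative)
    (hfine : Kato2004.exists_multDivisibilityInputs_fine)
    (hJs : thm61_splitMultiplicative) (hJn : thm61_nonsplitMultiplicative)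
    (hGZK : rank_eq_analyticRank_of_analyticRank_le_one)
    (hGS : ∀ (W : WeierstrassCurve ℚ) [W.IsElliptic] [W.IsGloballyMinimal] (p : ℕ) [Fact p.Prime],
      greenberg_stevens (W := W) (p := p))
    (hcert : ∀ (W : WeierstrassCurve ℚ) [W.IsElliptic] [W.IsGloballyMinimal] (p : ℕ) [Fact p.Prime],
      ClassX11a W p → ¬ Surj W p → 5 ≤ p → ¬ X11a.ShaAnUnit W p → X11a.MuAnZeroAt W p) :
    ∀ (W : WeierstrassCurve ℚ) [W.IsElliptic] [W.IsGloballyMinimal] (p : ℕ) [Fact p.Prime],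
      ClassX11a W p → ¬ Surj W p → 5 ≤ p → ¬ X11a.ShaAnUnit W p → MissingLowerBoundAt W p := by
  intro W _ _ p _ hX hnsj hp hu
  exact hX.missingLowerBoundAt_of_muAnZeroAt_of_not_surj_of_facts hNf h311 hT1a hT2 hT1b h61 h326 h12 hns
    hsp h15 h18 hfine hJs hJn hGZK (hGS W p) hnsj hp (hcert W p hX hnsj hp hu)

/-- **The lower half on the whole non-surjective X11a locus at `p ∈ {5,7}` from the K2 route's constant
`Theorems.NonSurjCornerTwinMuAn` (= item 19948 `Theses.ErratumRoadFive.NonSurjCornerTwinMuAn` BY NAME,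
the 3rd binder of the corner glue `Theorems.nonSurjCorner_of_branchesAn`) and the named facts.** The
constant's body IS «`μ^an = 0` at every X11a pair with `ρ̄` not onto, `p ∈ {5,7}`, `p ∣ ord_p Δ_min`» in
the allowable-root currency (§1); `p ∣ ord_p Δ_min` is automatic from `¬ Surj` (`ClassX11a.surj_of_not_dvd`,
Tate's transvection). Hence the corner's 5th binder `NonSurjCornerLowerX11a` (item 19950 := 19064) is,
on the locus where the corner uses it (non-surjective twists, `p ∈ {5,7}`), a CONSEQUENCE of its 3rd
binder + these facts (planner's call). CONDITIONAL; closes nothing by itself.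
[cite: GreenbergLNM1716, Conj. 1.11 (shape)] [cite: SilvermanATAEC1994, V.6 Prop. 6.1 (p. 410)]
[cite: EmertonPollackWeston2006, Thm. 5.1.3] [cite: Wan2015, Thm. 4] -/
theorem lowerNonSurj_fiveSeven_of_nonSurjCornerTwinMuAn_of_facts
    (hNf : exists_isNewformOf)
    (h311 : thm311_cotorsion_weightK_member_ofLevel) (hT1a : thm1_muAlg_of_weightK_member_ofLevel)
    (hT2 : Wan2015.thm4_rational_weightK_member_of_bdd_ofLevel_irred)
    (hT1b : thm513_transfer_from_weightK_member_of_bdd_ofLevel)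
    (h61 : DeligneSerre1974.thm61_exists_adicGaloisRep) (h326 : Hida2000_thm326_ordinary)
    (h12 : Kato2004.thm12_4)
    (hns : Kato2004.exists_multDivisibilityInputs_nonsplit)
    (hsp : Kato2004.exists_multDivisibilityInputs_split)
    (h15 : thm15_isTorsion_multiplicative_rat)
    (h18 : Wuthrich2014.corollary18_padicLFunction_mem_iwasawaAlgebra_multiplicative)
    (hfine : Kato2004.exists_multDivisibilityInputs_fine)
    (hJs : thm61_splitMultiplicative) (hJn : thm61_nonsplitMultiplicative)
    (hGZK : rank_eq_analyticRank_of_analyticRank_le_one)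
    (hGS : ∀ (W : WeierstrassCurve ℚ) [W.IsElliptic] [W.IsGloballyMinimal] (p : ℕ) [Fact p.Prime],
      greenberg_stevens (W := W) (p := p))
    (h57 : Summit.BirchSwinnertonDyer.BirchSwinnertonDyer.Theorems.NonSurjCornerTwinMuAn) :
    ∀ (W : WeierstrassCurve ℚ) [W.IsElliptic] [W.IsGloballyMinimal] (p : ℕ) [Fact p.Prime],
      ClassX11a W p → ¬ Surj W p → (p = 5 ∨ p = 7) → MissingLowerBoundAt W p := by
  intro W _ _ p _ hX hnsj h57'
  have hp : 5 ≤ p := by rcases h57' with rfl | rfl <;> omega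
  have hdvd : p ∣ padicValInt p W.minimalDiscriminantInt := by
    by_contra hΔ
    exact hnsj (ClassX11a.surj_of_not_dvd W p hX hΔ)
  have hμ : X11a.MuAnZeroAt W p :=
    muAnZeroAt_of_allowableRootShape W p (fun f hf ϖ hϖ a L h1 h2 hL =>
      h57 W p hX hnsj h57' hdvd f hf ϖ hϖ a L h1 h2 hL)
  exact hX.missingLowerBoundAt_of_muAnZeroAt_of_not_surj_of_facts hNf h311 hT1a hT2 hT1b h61 h326 h12 hns
    hsp h15 h18 hfine hJs hJn hGZK (hGS W p) hnsj hp hμ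

/-- **The lower half on the whole non-surjective X11a locus at `p ≥ 5`** from `Theorems.NonSurjCornerTwinMuAn`
(item 19948), the named facts, and Balakrishnan–Dogra–Müller–Tuitman–Vonk 2019 Thm. 1.2 (`hB`: at a
multiplicative `p ≥ 11` an irreducible `ρ̄_{E,p}` is onto, so the locus is `p ∈ {5,7}`;
`eq_five_or_eq_seven_of_mult_of_irr_of_not_surj`). This is the registered stub `stub_lowerNonSurjDeep`
restricted to `p ≥ 5` with its `¬ X11a.ShaAnUnit` binder UNUSED — CONDITIONAL on 19948 + facts; the
`p = 3` part of the stub (images 3Ns ∕ 3Nn) is untouched. Closes nothing by itself.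
[cite: BalakrishnanEtAl2019, §1 Thm. 1.2 (arXiv:1711.05846 p. 2)] [cite: GreenbergLNM1716, Conj. 1.11 (shape)]
[cite: EmertonPollackWeston2006, Thm. 5.1.3] [cite: Wan2015, Thm. 4] -/
theorem lowerNonSurj_five_of_nonSurjCornerTwinMuAn_of_facts
    (hNf : exists_isNewformOf)
    (h311 : thm311_cotorsion_weightK_member_ofLevel) (hT1a : thm1_muAlg_of_weightK_member_ofLevel)
    (hT2 : Wan2015.thm4_rational_weightK_member_of_bdd_ofLevel_irred)
    (hT1b : thm513_transfer_from_weightK_member_of_bdd_ofLevel)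
    (h61 : DeligneSerre1974.thm61_exists_adicGaloisRep) (h326 : Hida2000_thm326_ordinary)
    (h12 : Kato2004.thm12_4)
    (hns : Kato2004.exists_multDivisibilityInputs_nonsplit)
    (hsp : Kato2004.exists_multDivisibilityInputs_split)
    (h15 : thm15_isTorsion_multiplicative_rat)
    (h18 : Wuthrich2014.corollary18_padicLFunction_mem_iwasawaAlgebra_multiplicative)
    (hfine : Kato2004.exists_multDivisibilityInputs_fine)
    (hJs : thm61_splitMultiplicative) (hJn : thm61_nonsplitMultiplicative)
    (hGZK : rank_eq_analyticRank_of_analyticRank_le_one)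
    (hGS : ∀ (W : WeierstrassCurve ℚ) [W.IsElliptic] [W.IsGloballyMinimal] (p : ℕ) [Fact p.Prime],
      greenberg_stevens (W := W) (p := p))
    (hB : thm12_not_le_normalizer_splitCartan)
    (h57 : Summit.BirchSwinnertonDyer.BirchSwinnertonDyer.Theorems.NonSurjCornerTwinMuAn) :
    ∀ (W : WeierstrassCurve ℚ) [W.IsElliptic] [W.IsGloballyMinimal] (p : ℕ) [Fact p.Prime],
      ClassX11a W p → ¬ Surj W p → 5 ≤ p → ¬ X11a.ShaAnUnit W p → MissingLowerBoundAt W p := by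
  intro W _ _ p _ hX hnsj hp _hu
  exact lowerNonSurj_fiveSeven_of_nonSurjCornerTwinMuAn_of_facts hNf h311 hT1a hT2 hT1b h61 h326 h12 hns
    hsp h15 h18 hfine hJs hJn hGZK hGS h57 W p hX hnsj
    (GaloisImage.eq_five_or_eq_seven_of_mult_of_irr_of_not_surj W p hB hp hX.mult hX.irr hnsj)

end ClassLevel

end Summit.BirchSwinnertonDyer.BirchSwinnertonDyer.Theorems.NonSurjChain

end
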